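import Summits.SmoothPoincare4.SmoothPoincare4.Theorems.EntropyRungSubcylindricalExistenceTheoremA
import HarnessLib

/-!
# Terminal skeleton T-c9/c10 of crux stmt-SmoothPoincare4-10871 `EntropyRung.SubcylindricalExistence` (ENT),
line `curvature-dimension-entropy-floor` — lead c9 (eleventh lead seat), re-registered unchanged by leads c10,
c11 and c12 (twelfth–fourteenth seats), 2026-08-17 (c12 re-checked on the farm: rc 0, 1 sorry; `#print axioms
subcylindricalExistence_of_ricciFatSphere` = {propext, Classical.choice, Quot.sound})

State of the line (unchanged since lead gen-1 / c8 / c9): every stub of the planner skeleton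
`Cruxes/SubcylindricalExistence/Lines/curvature-dimension-entropy-floor.lean` is LANDED except its
transfer stub D (`stub_ricciFatMetric`), and D is fed ONLY by route RicciFat's crux item
stmt-SmoothPoincare4-5192 (`RicciFat.RicciFatSphere`, open, `[difficulty: open-problem]`), through the
unconditional tree theorem `subcylindricalExistence_of_ricciFatSphere` (TheoremA.lean, `δ = 1/50`).
Given the route's own rung (stmt-10869) the crux, D and stmt-5192 are each equivalent to the summit
(`Theorems.subcylindricalExistence_iff_spc4`, `ricciFatMetric_iff_spc4` p96669,
`subcylindricalExistence_iff_ricciFatSphere` / `ricciFatSphere_iff_spc4` p138579).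

So the honest skeleton of this line has exactly ONE stub, and that stub is an EXISTING LEDGER ITEM of
another route, stated here VERBATIM BY NAME (not restated): `stub_ricciFatSphere_stmt5192 :
RicciFat.RicciFatSphere`. It is NOT a worker obligation of this crux (never seat a stub-worker /
siege on it: it is item stmt-SmoothPoincare4-5192, claimed through route RicciFat's own queue); it is
the machine-readable form of the terminal state `blocked-on: stmt-SmoothPoincare4-5192`.
When stmt-5192 lands as `T : RicciFat.RicciFatSphere`, the crux closes by
`subcylindricalExistence_of_ricciFatSphere T` (one line, this file with the `sorry` replaced).
-/

-- the registered namespace repeats a component (`Summit.SmoothPoincare4.SmoothPoincare4`)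
set_option linter.dupNamespace false

namespace Summit.SmoothPoincare4.SmoothPoincare4.Cruxes.SubcylindricalExistence.LineCurvatureDimensionEntropyFloor

/-- **Stub D″ = item stmt-SmoothPoincare4-5192 verbatim** (route RicciFat's crux `RicciFatSphere`:
every smooth homotopy 4-sphere carries, for every `δ > 0`, a `C^∞` Riemannian metric with Levi-Civita
connection, `Ric ≥ 3g` and `Vol ≥ (1 − δ)·8π²/3`). SPC4-hard: with the rung it is `↔ SmoothPoincare4`
(`Theorems.ricciFatSphere_iff_spc4`, p138579). Not a worker obligation — it is an existing item. -/
theorem stub_ricciFatSphere_stmt5192 :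
    _root_.Summit.SmoothPoincare4.SmoothPoincare4.Theses.RicciFat.RicciFatSphere := by
  sorry

/-- **Composition**: the crux `EntropyRung.SubcylindricalExistence` BY NAME from the single stub, via
the landed Theorem A bridge `subcylindricalExistence_of_ricciFatSphere` (unconditional, `δ = 1/50`:
`Ric ≥ 3g` gives `R ≥ 12 > 0`, and the curvature-dimension entropy floor at `Vol ≥ 0.98·8π²/3` gives
`μ(g,τ) ≥ ν_cyl + δ'` for all `τ > 0`). -/
theorem SubcylindricalExistence_of :
    _root_.Summit.SmoothPoincare4.SmoothPoincare4.Theses.EntropyRung.SubcylindricalExistence :=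
  _root_.Summit.SmoothPoincare4.SmoothPoincare4.Theorems.subcylindricalExistence_of_ricciFatSphere
    stub_ricciFatSphere_stmt5192

end Summit.SmoothPoincare4.SmoothPoincare4.Cruxes.SubcylindricalExistence.LineCurvatureDimensionEntropyFloor
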